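import Summits.BirchSwinnertonDyer.BirchSwinnertonDyer.Theorems.PAdicOrderV2PadicBSDrankOfItems
import Summits.BirchSwinnertonDyer.BirchSwinnertonDyer.Theorems.PAdicOrderV2PadicBSDrankResidueTwoAnatomy

/-!
# Crux #3 `PAdicOrderPadicBSDrankR2` (stmt-BirchSwinnertonDyer-0490) from the route items and their
# `p = 2` companions (line `Sketch`, lead c3 — second glue file, `--supports stmt-BirchSwinnertonDyer-0490`)

The `p = 2` residue of the crux, given the route items `PAdicOrderMainConjectureR7` (stmt-15426,
`3 ≤ p`), `PAdicOrderSemisimpleR3` (stmt-0509, `p ≠ 2`) and `SelmerRankShaPFinite` (stmt-0132, every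
`p`), is closed by the two conjectures the first two items EXCLUDE by their parity guards, taken at
`p = 2` alone:

* (MC₂) Mazur's main conjecture in `Λ ⊗ ℚ_2` at a good ordinary `2` — the body of stmt-15426 with
  `3 ≤ p` replaced by `p = 2`;
* (SS₂) Greenberg's Conj. 1.12 at `T` at `p = 2` — the body of stmt-0509 with `p ≠ 2` replaced by
  `p = 2`.

Mazur's control theorem at `p = 2` is NOT an extra input: the tree theorem
`Greenberg1999_coinvariantsRank_eq_selmerCorank_rat_holds` (2026-08-17) has no parity hypothesis. Hence
`pAdicOrderPadicBSDrankR2_of_items_of_conjecturesAtTwo : R7 → 0509 → 0132 → MC₂ → SS₂ → crux` — the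
glue for a planner split of the crux into the three items and two `p = 2` companion items (no
Literature debt at all, no Kato at `2`), the alternative to the split through Kato's Thm. 18.4 and the
L-side residue NE2⁺ (`pAdicOrderPadicBSDrankR2_of_items`). The `p = 2` step is the landed
`padicBSDrank_residueTwo_of_conjectures` (`…ResidueTwoAnatomy`, p135931: the odd-`p` proof verbatim).
Conversely NE2⁺ follows from MC₂ ∧ SS₂ (`noExcessTwoPos_of_conjecturesAtTwo`).

Finally, ROUTE ITEMS ONLY: crux #3 follows from the route's other crux #2 `PAdicOrderComparisonR2`
(stmt-0489: `ord_T L_p = r_an` at every good ordinary `p`, parity-free) and the three Selmer-side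
items (`pAdicOrderPadicBSDrankR2_of_items_of_comparison`): `ord_T L_p = r_an = ord_T L_q = rank` with
`q` an odd good ordinary prime. So the `p = 2` residue of crux #3 is contained in crux #2's, and the
items ∧ crux #2 give `rank = r_an` for every modular `E/ℚ`
(`mordellWeilRank_eq_analyticRank_of_items_of_comparison`).

References: B. Mazur, J. Tate, J. Teitelbaum, Invent. Math. 84 (1986), §II.10 (BSD(`p`) at every good
ordinary `p`); R. Greenberg, LNM 1716 (1999), §1 Conj. 1.11–1.13, Thm 1.2.
-/

-- D-0017: single-problem summit, so `Summit.BirchSwinnertonDyer.BirchSwinnertonDyer.…` repeats a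
-- namespace BY DESIGN.
set_option linter.dupNamespace false

namespace Summit.BirchSwinnertonDyer.BirchSwinnertonDyer.Theorems

open scoped MatrixGroups ModularForm
open CongruenceSubgroup Literature.NumberTheory.EllipticCurves
  Literature.NumberTheory.EllipticCurves.ModularForms
  Literature.NumberTheory.EllipticCurves.IwasawaAlgebra
open Summit.BirchSwinnertonDyer.BirchSwinnertonDyer.Theses.PAdicOrderV2
open Summit.BirchSwinnertonDyer.BirchSwinnertonDyer.Theses.SelmerRank (SelmerRankShaPFinite)

/-- **The crux from the three route items and their two `p = 2` companions.** Hypotheses: the items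
`PAdicOrderMainConjectureR7` (stmt-15426), `PAdicOrderSemisimpleR3` (stmt-0509), `SelmerRankShaPFinite`
(stmt-0132); (MC₂) the body of stmt-15426 at `p = 2` (Mazur's main conjecture in `Λ ⊗ ℚ_2` at a good
ordinary `2`: `X` torsion, `char_Λ X = (g)`, `ι g = 2^k L_2(E,T)`, for the cyclotomic data matching
the variable and any dual datum); (SS₂) the body of stmt-0509 at `p = 2` (`2^k T² x = 0 ⇒ 2^{k'} T x = 0`
on `X`). Conclusion: `PAdicOrderPadicBSDrankR2` at every good ordinary prime. Odd `p`:
`padicBSDrank_odd_of_items`; `p = 2`: `padicBSDrank_residueTwo_of_conjectures` fed with MC₂, SS₂,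
Mazur control at `2` (tree theorem `Greenberg1999_coinvariantsRank_eq_selmerCorank_rat_holds`, rank
clause) and `Ш[2^∞]` finite (item 0132).
[cite: MazurTateTeitelbaum1986Invent, §II.10] [cite: GreenbergLNM1716, §1 Conj. 1.12–1.13 and p. 65] -/
theorem pAdicOrderPadicBSDrankR2_of_items_of_conjecturesAtTwo (hMC : PAdicOrderMainConjectureR7)
    (hSS : PAdicOrderSemisimpleR3) (hSha : SelmerRankShaPFinite)
    (hMC2 : ∀ (W : WeierstrassCurve ℚ) [W.IsElliptic] [W.IsGloballyMinimal] (p : ℕ) [Fact p.Prime],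
      p = 2 → W.HasGoodReductionAtPrime p → ¬ (p : ℤ) ∣ W.frobeniusTrace p →
      ∀ (κ : ZpExtension ℚ p) (γ : Field.absoluteGaloisGroup ℚ), κ.IsCyclotomic → κ.IsTopGenerator γ →
      IsCyclotomicVariable p γ → ∀ {N : ℕ} [NeZero N] (f : CuspForm (Gamma0 N) 2), IsNewformOf W f →
      ∀ (D : W.SelmerDualData κ γ), D.IsTorsion ∧ ∃ (g : IwasawaAlgebra p) (k : ℤ),
        D.charIdeal = Ideal.span {g} ∧
        iwasawaToPowerSeries p g = PowerSeries.C ((p : ℚ_[p]) ^ k) *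
          padicLFunction f (unitRoot W p : ℚ_[p]))
    (hSS2 : ∀ (W : WeierstrassCurve ℚ) [W.IsElliptic] [W.IsGloballyMinimal] (p : ℕ) [Fact p.Prime],
      p = 2 → W.HasGoodReductionAtPrime p → ¬ (p : ℤ) ∣ W.frobeniusTrace p →
      ∀ (κ : ZpExtension ℚ p) (γ : Field.absoluteGaloisGroup ℚ), κ.IsCyclotomic → κ.IsTopGenerator γ →
      ∀ (D : W.SelmerDualData κ γ) (x : D.X),
      (∃ k : ℕ, (PowerSeries.C ((p : ℤ_[p]) ^ k) * PowerSeries.X ^ 2 : IwasawaAlgebra p) • x = 0) →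
        ∃ k : ℕ, (PowerSeries.C ((p : ℤ_[p]) ^ k) * PowerSeries.X : IwasawaAlgebra p) • x = 0) :
    PAdicOrderPadicBSDrankR2 := by
  intro W _ _ p _ hord N _ f hf
  by_cases hp2 : p = 2
  · exact padicBSDrank_residueTwo_of_conjectures W p hord f hf
      (fun κ γ hκ hγ hγ' D ↦ hMC2 W p hp2 hord.1 hord.2 κ γ hκ hγ hγ' f hf D)
      (fun κ γ hκ hγ D ↦ hSS2 W p hp2 hord.1 hord.2 κ γ hκ hγ D)
      (fun κ γ hκ hγ D ↦
        (Greenberg1999_coinvariantsRank_eq_selmerCorank_rat_holds W p hord.1 hord.2 κ γ hκ hγ D).2)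
      (hSha W p)
  · exact padicBSDrank_odd_of_items hMC hSS hSha W p hp2 hord f hf

/-- **NE2⁺ from the `p = 2` companions of the items**: (MC₂) ∧ (SS₂) (as in
`pAdicOrderPadicBSDrankR2_of_items_of_conjecturesAtTwo`) give, at a good ordinary `2` and for the
newform `f` of `E`, `ord_{T=0} L_2(E,T) = corank_{ℤ_2} Sel_{2^∞}(E/ℚ)` — hence the line's open stub
`stub_padicBSDrank_noExcessTwoPos` (`ord ≤ corank` in positive rank) — by the landed bookkeeping
`stub_order_eq_selmerCorank` with the SS-bridge `stub_ker_mulTRat_sq_eq` and Mazur control at `2`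
(tree theorem). No `Ш` input. [cite: GreenbergLNM1716, §1 Conj. 1.12 and p. 65] -/
theorem noExcessTwoPos_of_conjecturesAtTwo :
    (∀ (W : WeierstrassCurve ℚ) [W.IsElliptic] [W.IsGloballyMinimal] (p : ℕ) [Fact p.Prime], p = 2 → W.HasGoodReductionAtPrime p → ¬ (p : ℤ) ∣ W.frobeniusTrace p → ∀ (κ : Literature.NumberTheory.EllipticCurves.ZpExtension ℚ p) (γ : Field.absoluteGaloisGroup ℚ), κ.IsCyclotomic → κ.IsTopGenerator γ → Literature.NumberTheory.EllipticCurves.IsCyclotomicVariable p γ → ∀ {N : ℕ} [NeZero N] (f : CuspForm (CongruenceSubgroup.Gamma0 N) 2), Literature.NumberTheory.EllipticCurves.ModularForms.IsNewformOf W f → ∀ (D : W.SelmerDualData κ γ), D.IsTorsion ∧ ∃ (g : Literature.NumberTheory.EllipticCurves.IwasawaAlgebra p) (k : ℤ), D.charIdeal = Ideal.span {g} ∧ Literature.NumberTheory.EllipticCurves.iwasawaToPowerSeries p g = PowerSeries.C ((p : ℚ_[p]) ^ k) * Literature.NumberTheory.EllipticCurves.padicLFunction f (Literature.NumberTheory.EllipticCurves.unitRoot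 W p : ℚ_[p])) →
    (∀ (W : WeierstrassCurve ℚ) [W.IsElliptic] [W.IsGloballyMinimal] (p : ℕ) [Fact p.Prime], p = 2 → W.HasGoodReductionAtPrime p → ¬ (p : ℤ) ∣ W.frobeniusTrace p → ∀ (κ : Literature.NumberTheory.EllipticCurves.ZpExtension ℚ p) (γ : Field.absoluteGaloisGroup ℚ), κ.IsCyclotomic → κ.IsTopGenerator γ → ∀ (D : W.SelmerDualData κ γ) (x : D.X), (∃ k : ℕ, (PowerSeries.C ((p : ℤ_[p]) ^ k) * PowerSeries.X ^ 2 : Literature.NumberTheory.EllipticCurves.IwasawaAlgebra p) • x = 0) → ∃ k : ℕ, (PowerSeries.C ((p : ℤ_[p]) ^ k) * PowerSeries.X : Literature.NumberTheory.EllipticCurves.IwasawaAlgebra p) • x = 0) →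
    ∀ (W : WeierstrassCurve ℚ) [W.IsElliptic] [W.IsGloballyMinimal] (p : ℕ) [Fact p.Prime], p = 2 → Literature.NumberTheory.EllipticCurves.IsOrdinaryAt W p → ∀ {N : ℕ} [NeZero N] (f : CuspForm (CongruenceSubgroup.Gamma0 N) 2), Literature.NumberTheory.EllipticCurves.ModularForms.IsNewformOf W f → 1 ≤ W.mordellWeilRank → (Literature.NumberTheory.EllipticCurves.padicLFunction f (Literature.NumberTheory.EllipticCurves.unitRoot W p : ℚ_[p])).order ≤ W.selmerCorank p := by
  intro hMC2 hSS2 W _ _ p _ hp2 hord N _ f hf _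
  obtain ⟨κ, hκ, γ, hγ, hγ'⟩ := exists_isCyclotomic_isTopGenerator_isCyclotomicVariable_holds p
  obtain ⟨D⟩ := W.nonempty_selmerDualData_holds κ γ hγ
  obtain ⟨htors, hmc⟩ := hMC2 W p hp2 hord.1 hord.2 κ γ hκ hγ hγ' f hf D
  have hss := stub_ker_mulTRat_sq_eq p D.X (hSS2 W p hp2 hord.1 hord.2 κ γ hκ hγ D)
  have hct := (Greenberg1999_coinvariantsRank_eq_selmerCorank_rat_holds W p hord.1 hord.2 κ γ hκ hγ D).2
  exact (stub_order_eq_selmerCorank W p κ γ hκ hγ f D htors hmc hss hct).le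

/-! ## Crux #3 from crux #2 and the Selmer-side items (route items only) -/

/-- **`rank E(ℚ) = ord_{s=1} L(E,s)` for a modular `E/ℚ`, from the items and the comparison crux at
ONE odd good ordinary prime.** For `E/ℚ` (globally minimal `W`) with a newform `f`: at a good
ordinary prime `q ≥ 5` (which exists, `WeierstrassCurve.exists_good_ordinary_prime_holds`) the items
`PAdicOrderMainConjectureR7`, `PAdicOrderSemisimpleR3`, `SelmerRankShaPFinite` give
`ord_T L_q(E,T) = rank` (`padicBSDrank_odd_of_items`) and crux #2 `PAdicOrderComparisonR2` gives
`ord_T L_q(E,T) = r_an`. [cite: MazurTateTeitelbaum1986Invent, §II.10] -/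
theorem mordellWeilRank_eq_analyticRank_of_items_of_comparison (hMC : PAdicOrderMainConjectureR7)
    (hSS : PAdicOrderSemisimpleR3) (hSha : SelmerRankShaPFinite) (hCmp : PAdicOrderComparisonR2)
    (W : WeierstrassCurve ℚ) [W.IsElliptic] [W.IsGloballyMinimal] {N : ℕ} [NeZero N]
    (f : CuspForm (Gamma0 N) 2) (hf : IsNewformOf W f) : W.mordellWeilRank = W.analyticRank := by
  obtain ⟨q, hq, h5, hgood, hordq⟩ := WeierstrassCurve.exists_good_ordinary_prime_holds W
  have h1 := padicBSDrank_odd_of_items hMC hSS hSha W q (by omega) ⟨hgood, hordq⟩ f hf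
  have h2 := hCmp W q ⟨hgood, hordq⟩ f hf
  exact_mod_cast h1.symm.trans h2

/-- **Crux #3 `PAdicOrderPadicBSDrankR2` from crux #2 `PAdicOrderComparisonR2` and the three
Selmer-side items** `PAdicOrderMainConjectureR7` (stmt-15426), `PAdicOrderSemisimpleR3` (stmt-0509),
`SelmerRankShaPFinite` (stmt-0132) — ROUTE ITEMS ONLY, every good ordinary prime, `p = 2` included:
at `(W, p, f)`, `ord_T L_p = r_an` (crux #2 at `p`, parity-free) `= rank`
(`mordellWeilRank_eq_analyticRank_of_items_of_comparison`, i.e. the items and crux #2 at one odd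
prime). So the `p = 2` residue of crux #3 is contained in crux #2; in particular the route's two
cruxes need the prime `2` handled only once. [cite: MazurTateTeitelbaum1986Invent, §II.10] -/
theorem pAdicOrderPadicBSDrankR2_of_items_of_comparison (hMC : PAdicOrderMainConjectureR7)
    (hSS : PAdicOrderSemisimpleR3) (hSha : SelmerRankShaPFinite) (hCmp : PAdicOrderComparisonR2) :
    PAdicOrderPadicBSDrankR2 := by
  intro W _ _ p _ hord N _ f hf
  rw [hCmp W p hord f hf, mordellWeilRank_eq_analyticRank_of_items_of_comparison hMC hSS hSha hCmp W f hf]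

end Summit.BirchSwinnertonDyer.BirchSwinnertonDyer.Theorems
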